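import Mathlib
import HarnessLib
import Literature.Analysis.FluidPDE.FirstIntegralTransportDefect
import Summits.NavierStokesRegularity.NavierStokesRegularity.Theorems.PoloidalWindowDoorLrcModEntireJetCertTree
import Summits.NavierStokesRegularity.NavierStokesRegularity.Theorems.PoloidalWindowDoorLrcModEntireTHCertDictionary
import Summits.NavierStokesRegularity.NavierStokesRegularity.Theorems.PoloidalWindowDoorPoloidalWindowRigidityClebschVorticity

/-!
# Route `PoloidalWindowDoor`, item `LrcModEntire` (stmt-NavierStokesRegularity-20428) — `stub_localTHEmpty` FROM A CHECKED CERTIFICATE TREE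
# (wiring, part 2: tables, the five base laws and four pins as term lists, the local datum, the closing theorem)

Cell ns-regularity-ideate, seat ns-poloidal-K2-p3 gen 7 (lead of item 20428; `--supports stmt-NavierStokesRegularity-20428`; definitions reviewed).
Given a LIST of letters `L : List THLetter` (the engine's truncated jet; index = position, `n = L.length`):
* `tableOf L`, `maskOf L` — derivative tables/mask (`∂ⱼ` of a letter = the shifted letter if listed, MASKED if not; `M`/`A` letters have
  `∂ₓ = ∂_y = 0`); `jetMapOf L u μ A` — the jet map of the stub's data; `V L ℓ` — the variable of a letter;
* `lawPol L, lawDiv L, lawSh0 L, lawSh1 L, lawE L` (`thHyps L`, indices 0–4) — the four local laws of (TH) (shear counted twice) as term lists: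
  `W1ₓ − W0_y`, `W0ₓ + W1_y + W2_z`, `W_b,z − M00·W2_b`, `(1−M00)(W2ₜ + W0 W2ₓ + W1 W2_y + W2 W2_z − (W2ₓₓ+W2_yy+W2_zz)) − A00 − (M10 − M02)W2
  − ½ M01 W2² + 2 M01 W2_z`; `thPins L` = `[W2ₓ_z·W2_y − W2_yz·W2ₓ, M00, M00 − 1, M01]`; `baseLetters`, `lettersOK L`;
* `localDatum_of_stubData` — the stub's analytic data on `U ∋ p₀` IS a `LocalDatum L.length (tableOf L) (maskOf L) dirVec (thHyps L) (thPins L)`;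
* **`stub_localTHEmpty_of_checkTree`** — for every letter list containing the base letters and every certificate tree `t` with
  `checkTree L.length (tableOf L) (maskOf L) (thHyps L) (thPins L) t = true` (ONE `decide +kernel`), the registered stub `stub_localTHEmpty` of
  `Cruxes/LrcModEntire/Lines/twist_split.lean` (v4) holds VERBATIM — hence (tree) `stub_twistingTH` of item 20428, `stub_hyperbolicTH` of
  19708's `mixed_type`, and the (TH) half of `lrc_jet`'s `stub_twisting`.

WHAT THIS IS NOT: not a claim about Navier–Stokes and NOT a certificate: no tree `t` with `checkTree … = true` is known; producing one is the
exact-elimination lanes' task (nsreg-p7 g12, ns-poloidal-K2-p2 g6, K2-cert-1 g4).  bears_on LADDER-NS N0, item 20428 `stub_localTHEmpty`. [folklore]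
-/

noncomputable section

-- the summit and its single sub-problem share the name (CONVENTIONS §1), as in every Theorems file
set_option linter.dupNamespace false

namespace Summit.NavierStokesRegularity.NavierStokesRegularity.Theorems.PoloidalWindowDoorLrcModEntireTHCert

open _root_.Topology _root_.Filter Set Function
open scoped InnerProductSpace Laplacian
open Literature.Analysis.ValidatedNumerics Literature.Analysis.ValidatedNumerics.QMvPoly
open Literature.Analysis.Calculus.MvPoly
open Summit.NavierStokesRegularity.NavierStokesRegularity.Theorems.PoloidalWindowDoorLrcModEntireJetCertDefs
open Summit.NavierStokesRegularity.NavierStokesRegularity.Theorems.PoloidalWindowDoorLrcModEntireJetCertMasked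
open Summit.NavierStokesRegularity.NavierStokesRegularity.Theorems.PoloidalWindowDoorLrcModEntireJetCertTree
open Summit.NavierStokesRegularity.NavierStokesRegularity.Theorems.PoloidalWindowDoorLrcModEntireJetLetters
open Summit.NavierStokesRegularity.NavierStokesRegularity.Theorems.PoloidalWindowDoorLrcModEntireTHCertLetters
open Summit.NavierStokesRegularity.NavierStokesRegularity.Theorems.PoloidalWindowDoorLrcModEntireTHCertDictionary

/-! ### Tables, mask, jet map, variables, laws, pins -/

/-- The derivative table generated by a letter list (`∂ⱼ Xₐ` = the variable of the shifted letter if listed, else `[]`). [folklore] -/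
def tableOf (L : List THLetter) (j a : ℕ) : QMvPoly :=
  match L[a]? with
  | none => []
  | some ℓ =>
    match ℓ.shift j with
    | none => []
    | some ℓ' => if ℓ' ∈ L then QMvPoly.var L.length (L.idxOf ℓ') else []

/-- The mask generated by a letter list (`false` exactly when the shifted letter exists but is not listed). [folklore] -/
def maskOf (L : List THLetter) (j a : ℕ) : Bool :=
  match L[a]? with
  | none => false
  | some ℓ =>
    match ℓ.shift j with
    | none => true
    | some ℓ' => decide (ℓ' ∈ L)

/-- The jet map of the stub's data along a letter list. [folklore] -/
def jetMapOf (L : List THLetter) (u : ℝ → EuclideanSpace ℝ (Fin 3) → EuclideanSpace ℝ (Fin 3)) (μ A : ℝ → ℝ → ℝ) :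
    ℝ × EuclideanSpace ℝ (Fin 3) → EuclideanSpace ℝ (Fin L.length) :=
  mkJet fun i => letterFn u μ A L[i]

/-- The variable of a letter (by its position in the list). [folklore] -/
def V (L : List THLetter) (ℓ : THLetter) : QMvPoly := QMvPoly.var L.length (L.idxOf ℓ)

/-- Poloidality `∂ₓu₁ − ∂_yu₀`. [folklore] -/
def lawPol (L : List THLetter) : QMvPoly := V L (.W 1 0 1 0 0) ++ QMvPoly.smul (-1) (V L (.W 0 0 0 1 0))
/-- Incompressibility `∂ₓu₀ + ∂_yu₁ + ∂_zu₂`. [folklore] -/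
def lawDiv (L : List THLetter) : QMvPoly := V L (.W 0 0 1 0 0) ++ V L (.W 1 0 0 1 0) ++ V L (.W 2 0 0 0 1)
/-- Shear law `∂_zu₀ − μ ∂ₓu₂`. [folklore] -/
def lawSh0 (L : List THLetter) : QMvPoly := V L (.W 0 0 0 0 1) ++ QMvPoly.smul (-1) (QMvPoly.mul (V L (.M 0 0)) (V L (.W 2 0 1 0 0)))
/-- Shear law `∂_zu₁ − μ ∂_yu₂`. [folklore] -/
def lawSh1 (L : List THLetter) : QMvPoly := V L (.W 1 0 0 0 1) ++ QMvPoly.smul (-1) (QMvPoly.mul (V L (.M 0 0)) (V L (.W 2 0 0 1 0)))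
/-- The vertical momentum equation with the (TH) pressure law, everything on the left. [folklore] -/
def lawE (L : List THLetter) : QMvPoly :=
  QMvPoly.mul (QMvPoly.const 1 ++ QMvPoly.smul (-1) (V L (.M 0 0)))
      (V L (.W 2 1 0 0 0) ++ QMvPoly.mul (V L (.W 0 0 0 0 0)) (V L (.W 2 0 1 0 0)) ++
        QMvPoly.mul (V L (.W 1 0 0 0 0)) (V L (.W 2 0 0 1 0)) ++ QMvPoly.mul (V L (.W 2 0 0 0 0)) (V L (.W 2 0 0 0 1)) ++
        QMvPoly.smul (-1) (V L (.W 2 0 2 0 0) ++ V L (.W 2 0 0 2 0) ++ V L (.W 2 0 0 0 2)))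
    ++ QMvPoly.smul (-1) (V L (.A 0 0))
    ++ QMvPoly.smul (-1) (QMvPoly.mul (V L (.M 1 0) ++ QMvPoly.smul (-1) (V L (.M 0 2))) (V L (.W 2 0 0 0 0)))
    ++ QMvPoly.smul (-1/2) (QMvPoly.mul (V L (.M 0 1)) (QMvPoly.mul (V L (.W 2 0 0 0 0)) (V L (.W 2 0 0 0 0))))
    ++ QMvPoly.smul 2 (QMvPoly.mul (V L (.M 0 1)) (V L (.W 2 0 0 0 1)))
/-- The five base laws (indices 0–4). [folklore] -/
def thHyps (L : List THLetter) : List QMvPoly := [lawPol L, lawDiv L, lawSh0 L, lawSh1 L, lawE L]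
/-- The twist bracket `∂ₓ∂_zu₂·∂_yu₂ − ∂_y∂_zu₂·∂ₓu₂`. [folklore] -/
def pinTwist (L : List THLetter) : QMvPoly :=
  QMvPoly.mul (V L (.W 2 0 1 0 1)) (V L (.W 2 0 0 1 0)) ++ QMvPoly.smul (-1) (QMvPoly.mul (V L (.W 2 0 0 1 1)) (V L (.W 2 0 1 0 0)))
/-- The four pins `[twist, μ, μ − 1, ∂_zμ]`. [folklore] -/
def thPins (L : List THLetter) : List QMvPoly := [pinTwist L, V L (.M 0 0), V L (.M 0 0) ++ QMvPoly.const (-1), V L (.M 0 1)]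
/-- The letters the base laws and pins use. [folklore] -/
def baseLetters : List THLetter :=
  [.W 0 0 0 0 0, .W 1 0 0 0 0, .W 2 0 0 0 0, .W 0 0 1 0 0, .W 0 0 0 1 0, .W 0 0 0 0 1, .W 1 0 1 0 0, .W 1 0 0 1 0, .W 1 0 0 0 1,
   .W 2 1 0 0 0, .W 2 0 1 0 0, .W 2 0 0 1 0, .W 2 0 0 0 1, .W 2 0 2 0 0, .W 2 0 0 2 0, .W 2 0 0 0 2, .W 2 0 1 0 1, .W 2 0 0 1 1,
   .M 0 0, .M 1 0, .M 0 1, .M 0 2, .A 0 0]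
/-- «the letter list contains the base letters» (decidable). [folklore] -/
def lettersOK (L : List THLetter) : Bool := baseLetters.all fun ℓ => decide (ℓ ∈ L)

/-! ### Evaluation lemmas -/

/-- `ev (const c) = c`. [folklore] -/
theorem ev_const' {n : ℕ} (c : ℚ) (z : EuclideanSpace ℝ (Fin n)) : ev n (QMvPoly.const c) z = c := by
  simp [ev, QMvPoly.toMv_const, toFun_apply]

/-- The variable of a listed letter evaluates to the letter. [folklore] -/
theorem ev_V {L : List THLetter} {u : ℝ → EuclideanSpace ℝ (Fin 3) → EuclideanSpace ℝ (Fin 3)} {μ A : ℝ → ℝ → ℝ}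
    {ℓ : THLetter} (hℓ : ℓ ∈ L) (p : ℝ × EuclideanSpace ℝ (Fin 3)) :
    ev L.length (V L ℓ) (jetMapOf L u μ A p) = letterFn u μ A ℓ p := by
  have hlt : L.idxOf ℓ < L.length := List.idxOf_lt_length_iff.2 hℓ
  rw [V, show QMvPoly.var L.length (L.idxOf ℓ) = QMvPoly.var L.length ((⟨L.idxOf ℓ, hlt⟩ : Fin L.length) : ℕ) from rfl, ev,
    QMvPoly.toMv_var, toFun_X, jetMapOf, mkJet_apply]
  simp [List.getElem_idxOf hlt]

section Datum

variable {L : List THLetter} {u : ℝ → EuclideanSpace ℝ (Fin 3) → EuclideanSpace ℝ (Fin 3)} {μ A : ℝ → ℝ → ℝ}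
  {U : Set (ℝ × EuclideanSpace ℝ (Fin 3))}
  (hU : IsOpen U) (hu : AnalyticOnNhd ℝ (uncurry u) U)
  (hμ : ∀ p ∈ U, AnalyticAt ℝ (uncurry μ) (p.1, p.2 2)) (hA : ∀ p ∈ U, AnalyticAt ℝ (uncurry A) (p.1, p.2 2))

include hu hμ hA in
/-- The jet map is differentiable on `U`. [folklore] -/
theorem differentiableAt_jetMapOf {p : ℝ × EuclideanSpace ℝ (Fin 3)} (hp : p ∈ U) : DifferentiableAt ℝ (jetMapOf L u μ A) p :=
  differentiableAt_mkJet fun _ => differentiableAt_letterFn hu hμ hA _ hp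

include hU hu hμ hA in
/-- **The tables hold** along the jet map (for the tabled letters). [folklore] -/
theorem tables_jetMapOf (j : ℕ) (i : Fin L.length) (hi : maskOf L j i = true) {p : ℝ × EuclideanSpace ℝ (Fin 3)} (hp : p ∈ U) :
    fderiv ℝ (fun q => jetMapOf L u μ A q i) p (dirVec j) = ev L.length (tableOf L j i) (jetMapOf L u μ A p) := by
  have hget : L[(i : ℕ)]? = some L[i] := by simp
  simp only [maskOf, hget] at hi
  show fderiv ℝ (letterFn u μ A L[i]) p (dirVec j) = _
  simp only [tableOf, hget]
  cases hs : (L[i]).shift j with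
  | none =>
    simp only []
    rw [fderiv_letterFn_none hμ hA hs hp, ev_nil]
  | some ℓ' =>
    simp only [hs, decide_eq_true_eq] at hi
    simp only [hi, if_true]
    rw [fderiv_letterFn_shift hU hu hμ hA hs hp]
    exact (ev_V hi p).symm

end Datum

/-! ### Two slice identities -/

section Slice

variable {u : ℝ → EuclideanSpace ℝ (Fin 3) → EuclideanSpace ℝ (Fin 3)} {U : Set (ℝ × EuclideanSpace ℝ (Fin 3))}

/-- Local Laplacian formula in the standard frame for the slice `y ↦ u₂(t,y)` at points of `U`. [folklore] -/
theorem laplacian_slice_eq (hu : AnalyticOnNhd ℝ (uncurry u) U) {p : ℝ × EuclideanSpace ℝ (Fin 3)} (hp : p ∈ U) :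
    (Δ (fun y => u p.1 y 2)) p.2 = ∑ k : Fin 3, fderiv ℝ (fun y => fderiv ℝ (fun y' => u p.1 y' 2) y (EuclideanSpace.single k 1)) p.2
      (EuclideanSpace.single k 1) := by
  rw [Literature.Analysis.FluidPDE.laplacian_eq_sum_fderiv_fderiv_curried (EuclideanSpace.basisFun (Fin 3) ℝ)]
  refine Finset.sum_congr rfl fun k _ => ?_
  -- the slice is analytic at `p.2`, so `fderiv` of it is differentiable there
  have ha : AnalyticAt ℝ (fun y => u p.1 y 2) p.2 := by
    have h1 : AnalyticAt ℝ (fun q : ℝ × EuclideanSpace ℝ (Fin 3) => u q.1 q.2 2) (p.1, p.2) := analyticOnNhd_comp hu 2 p hp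
    have h2 : AnalyticAt ℝ (fun y : EuclideanSpace ℝ (Fin 3) => ((p.1, y) : ℝ × EuclideanSpace ℝ (Fin 3))) p.2 :=
      analyticAt_const.prod analyticAt_id
    exact h1.comp h2
  have hd : DifferentiableAt ℝ (fderiv ℝ (fun y => u p.1 y 2)) p.2 := ha.fderiv.differentiableAt
  rw [EuclideanSpace.basisFun_apply, fderiv_clm_apply hd (differentiableAt_const _)]
  simp

/-- Second slice derivatives of `u₂` through the vector slice `u t`. [folklore] -/
theorem fderiv_fderiv_slice_comp (hu : AnalyticOnNhd ℝ (uncurry u) U) (hU : IsOpen U) {p : ℝ × EuclideanSpace ℝ (Fin 3)} (hp : p ∈ U) (eo ei : EuclideanSpace ℝ (Fin 3)) :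
    fderiv ℝ (fun y => fderiv ℝ (fun y' => u p.1 y' 2) y ei) p.2 eo = fderiv ℝ (fun y => fderiv ℝ (u p.1) y ei 2) p.2 eo := by
  have hev : (fun y => fderiv ℝ (fun y' => u p.1 y' 2) y ei) =ᶠ[𝓝 p.2] fun y => fderiv ℝ (u p.1) y ei 2 := by
    have hc : ContinuousAt (fun y : EuclideanSpace ℝ (Fin 3) => ((p.1, y) : ℝ × EuclideanSpace ℝ (Fin 3))) p.2 := by fun_prop
    filter_upwards [hc.preimage_mem_nhds (hU.mem_nhds (show (p.1, p.2) ∈ U from hp))] with y hy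
    exact fderiv_slice_comp hu (p := (p.1, y)) hy ei 2
  rw [hev.fderiv_eq]

end Slice

/-! ### The laws and pins along the stub's data -/

section Laws

variable {L : List THLetter} (hL : lettersOK L = true)
include hL

/-- Membership of the base letters. [folklore] -/
theorem mem_of_lettersOK {ℓ : THLetter} (h : ℓ ∈ baseLetters) : ℓ ∈ L := by
  have := List.all_eq_true.1 hL ℓ h
  simpa using this

variable {u : ℝ → EuclideanSpace ℝ (Fin 3) → EuclideanSpace ℝ (Fin 3)} {μ A : ℝ → ℝ → ℝ}
  {U : Set (ℝ × EuclideanSpace ℝ (Fin 3))} (hU : IsOpen U) (hu : AnalyticOnNhd ℝ (uncurry u) U)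
  (hμ : ∀ p ∈ U, AnalyticAt ℝ (uncurry μ) (p.1, p.2 2))

include hU hu hμ in
/-- **The five base laws vanish on `U` along the stub's data.** [folklore] -/
theorem thHyps_vanish
    (hpol : ∀ p ∈ U, fderiv ℝ (u p.1) p.2 (EuclideanSpace.single 0 1) 1 = fderiv ℝ (u p.1) p.2 (EuclideanSpace.single 1 1) 0)
    (hdiv : ∀ p ∈ U, fderiv ℝ (u p.1) p.2 (EuclideanSpace.single 0 1) 0 + fderiv ℝ (u p.1) p.2 (EuclideanSpace.single 1 1) 1 +
      fderiv ℝ (u p.1) p.2 (EuclideanSpace.single 2 1) 2 = 0)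
    (hsh : ∀ p ∈ U, ∀ b : Fin 3, b ≠ 2 →
      fderiv ℝ (u p.1) p.2 (EuclideanSpace.single 2 1) b = μ p.1 (p.2 2) * fderiv ℝ (u p.1) p.2 (EuclideanSpace.single b 1) 2)
    (hE : ∀ p ∈ U,
      (1 - μ p.1 (p.2 2)) *
          (deriv (fun s => u s p.2 2) p.1 + fderiv ℝ (fun y => u p.1 y 2) p.2 (u p.1 p.2) - Δ (fun y => u p.1 y 2) p.2) =
        A p.1 (p.2 2) + (deriv (fun s => μ s (p.2 2)) p.1 - deriv (deriv (μ p.1)) (p.2 2)) * u p.1 p.2 2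
          + deriv (μ p.1) (p.2 2) / 2 * u p.1 p.2 2 ^ 2 - 2 * deriv (μ p.1) (p.2 2) * fderiv ℝ (u p.1) p.2 (EuclideanSpace.single 2 1) 2) :
    ∀ Lw ∈ thHyps L, ∀ p ∈ U, ev L.length Lw (jetMapOf L u μ A p) = 0 := by
  have m := fun ℓ (h : ℓ ∈ baseLetters) => mem_of_lettersOK hL h
  intro Lw hLw p hp
  simp only [thHyps, List.mem_cons, List.mem_nil_iff, or_false] at hLw
  rcases hLw with rfl | rfl | rfl | rfl | rfl
  · -- poloidal
    rw [lawPol, ev_append, ev_smul, ev_V (m _ (by simp [baseLetters])), ev_V (m _ (by simp [baseLetters])),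
      letterFn_Wx hu 1 hp, letterFn_Wy hu 0 hp, hpol p hp]
    push_cast; ring
  · -- divergence
    rw [lawDiv, ev_append, ev_append, ev_V (m _ (by simp [baseLetters])), ev_V (m _ (by simp [baseLetters])),
      ev_V (m _ (by simp [baseLetters])), letterFn_Wx hu 0 hp, letterFn_Wy hu 1 hp, letterFn_Wz hu 2 hp]
    exact hdiv p hp
  · -- shear, b = 0
    rw [lawSh0, ev_append, ev_smul, ev_mul, ev_V (m _ (by simp [baseLetters])), ev_V (m _ (by simp [baseLetters])),
      ev_V (m _ (by simp [baseLetters])), letterFn_Wz hu 0 hp, letterFn_M00, letterFn_Wx hu 2 hp, hsh p hp 0 (by decide)]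
    push_cast; ring
  · -- shear, b = 1
    rw [lawSh1, ev_append, ev_smul, ev_mul, ev_V (m _ (by simp [baseLetters])), ev_V (m _ (by simp [baseLetters])),
      ev_V (m _ (by simp [baseLetters])), letterFn_Wz hu 1 hp, letterFn_M00, letterFn_Wy hu 2 hp, hsh p hp 1 (by decide)]
    push_cast; ring
  · -- E
    have hconv : fderiv ℝ (fun y => u p.1 y 2) p.2 (u p.1 p.2) =
        ∑ k : Fin 3, u p.1 p.2 k * fderiv ℝ (u p.1) p.2 (EuclideanSpace.single k 1) 2 := by
      rw [Summit.NavierStokesRegularity.NavierStokesRegularity.Theorems.PoloidalWindowDoorPoloidalWindowRigidityClebschVorticity.clf_apply_eq_sum3]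
      refine Finset.sum_congr rfl fun k _ => ?_
      rw [fderiv_slice_comp hu hp]
    have hlap := laplacian_slice_eq hu hp
    simp only [Fin.sum_univ_three, fderiv_fderiv_slice_comp hu hU hp] at hconv hlap
    have h := hE p hp
    rw [hconv, hlap] at h
    simp only [lawE, ev_append, ev_smul, ev_mul, ev_const']
    rw [ev_V (m _ (by simp [baseLetters])), ev_V (m _ (by simp [baseLetters])), ev_V (m _ (by simp [baseLetters])),
      ev_V (m _ (by simp [baseLetters])), ev_V (m _ (by simp [baseLetters])), ev_V (m _ (by simp [baseLetters])),
      ev_V (m _ (by simp [baseLetters])), ev_V (m _ (by simp [baseLetters])), ev_V (m _ (by simp [baseLetters])),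
      ev_V (m _ (by simp [baseLetters])), ev_V (m _ (by simp [baseLetters])), ev_V (m _ (by simp [baseLetters])),
      ev_V (m _ (by simp [baseLetters])), ev_V (m _ (by simp [baseLetters])), ev_V (m _ (by simp [baseLetters]))]
    rw [letterFn_M00, letterFn_Wt hu 2 hp, letterFn_W0, letterFn_W0, letterFn_W0, letterFn_Wx hu 2 hp, letterFn_Wy hu 2 hp,
      letterFn_Wz hu 2 hp, letterFn_W2xx hu hU hp, letterFn_W2yy hu hU hp, letterFn_W2zz hu hU hp, letterFn_A00,
      letterFn_M10 hμ hp, letterFn_M02 hμ hp, letterFn_M01 hμ hp]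
    push_cast
    linear_combination h

include hU hu hμ in
/-- **The four pins are non-zero at the base point.** [folklore] -/
theorem thPins_ne_zero {p₀ : ℝ × EuclideanSpace ℝ (Fin 3)} (hp₀ : p₀ ∈ U)
    (htw : fderiv ℝ (fun y => fderiv ℝ (u p₀.1) y (EuclideanSpace.single 2 1) 2) p₀.2 (EuclideanSpace.single 0 1) *
            fderiv ℝ (u p₀.1) p₀.2 (EuclideanSpace.single 1 1) 2 -
          fderiv ℝ (fun y => fderiv ℝ (u p₀.1) y (EuclideanSpace.single 2 1) 2) p₀.2 (EuclideanSpace.single 1 1) *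
            fderiv ℝ (u p₀.1) p₀.2 (EuclideanSpace.single 0 1) 2 ≠ 0)
    (hm0 : μ p₀.1 (p₀.2 2) ≠ 0) (hm1 : μ p₀.1 (p₀.2 2) ≠ 1) (hmz : deriv (μ p₀.1) (p₀.2 2) ≠ 0) :
    ∀ π ∈ thPins L, ev L.length π (jetMapOf L u μ A p₀) ≠ 0 := by
  have m := fun ℓ (h : ℓ ∈ baseLetters) => mem_of_lettersOK hL h
  intro π hπ
  simp only [thPins, List.mem_cons, List.mem_nil_iff, or_false] at hπ
  rcases hπ with rfl | rfl | rfl | rfl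
  · rw [pinTwist, ev_append, ev_smul, ev_mul, ev_mul, ev_V (m _ (by simp [baseLetters])), ev_V (m _ (by simp [baseLetters])),
      ev_V (m _ (by simp [baseLetters])), ev_V (m _ (by simp [baseLetters])), letterFn_W2xz hu hU hp₀, letterFn_Wy hu 2 hp₀,
      letterFn_W2yz hu hU hp₀, letterFn_Wx hu 2 hp₀]
    push_cast
    intro h; apply htw; linear_combination h
  · rw [ev_V (m _ (by simp [baseLetters])), letterFn_M00]; exact hm0
  · rw [ev_append, ev_const', ev_V (m _ (by simp [baseLetters])), letterFn_M00]
    push_cast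
    intro h; apply hm1; linear_combination h
  · rw [ev_V (m _ (by simp [baseLetters])), letterFn_M01 hμ hp₀]; exact hmz

end Laws


/-! ### Compact input encoding for exported certificates (engine convenience; no semantics needed) -/

/-- Dense exponent vector of length `n` from a sparse monomial `[(letter index, exponent), …]`. [folklore] -/
def denseExp (n : ℕ) (m : List (ℕ × ℕ)) : List ℕ :=
  (List.range n).map fun i => ((m.filter fun e => e.1 = i).map fun e => e.2).sum

/-- A term list from sparse monomials with integer numerators and natural denominators:
`mkPoly n [(mono, num, den), …] = Σ (num/den)·X^mono`. [folklore] -/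
def mkPoly (n : ℕ) (ts : List (List (ℕ × ℕ) × ℤ × ℕ)) : QMvPoly :=
  ts.map fun t => (denseExp n t.1, (t.2.1 : ℚ) / (t.2.2 : ℚ))

/-! ### The closing theorem -/

/-- **`stub_localTHEmpty` FROM A CHECKED CERTIFICATE TREE.**  For every letter list `L` containing the base letters and every certificate
tree `t` with `checkTree L.length (tableOf L) (maskOf L) (thHyps L) (thPins L) t = true`, the registered stub `stub_localTHEmpty` (skeleton
`twist_split` v4 of item 20428) holds, VERBATIM. [folklore] -/
theorem stub_localTHEmpty_of_checkTree (L : List THLetter) (hL : lettersOK L = true) (t : CertTree)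
    (ht : checkTree L.length (tableOf L) (maskOf L) (thHyps L) (thPins L) t = true) :
    ∀ (u : ℝ → EuclideanSpace ℝ (Fin 3) → EuclideanSpace ℝ (Fin 3)) (μ A : ℝ → ℝ → ℝ)
      (U : Set (ℝ × EuclideanSpace ℝ (Fin 3))) (p₀ : ℝ × EuclideanSpace ℝ (Fin 3)),
      IsOpen U → p₀ ∈ U →
      AnalyticOnNhd ℝ (Function.uncurry u) U →
      (∀ p ∈ U, AnalyticAt ℝ (Function.uncurry μ) (p.1, p.2 2)) →
      (∀ p ∈ U, AnalyticAt ℝ (Function.uncurry A) (p.1, p.2 2)) →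
      (∀ p ∈ U, fderiv ℝ (u p.1) p.2 (EuclideanSpace.single 0 1) 1 = fderiv ℝ (u p.1) p.2 (EuclideanSpace.single 1 1) 0) →
      (∀ p ∈ U, fderiv ℝ (u p.1) p.2 (EuclideanSpace.single 0 1) 0 + fderiv ℝ (u p.1) p.2 (EuclideanSpace.single 1 1) 1 +
        fderiv ℝ (u p.1) p.2 (EuclideanSpace.single 2 1) 2 = 0) →
      (∀ p ∈ U, ∀ b : Fin 3, b ≠ 2 →
        fderiv ℝ (u p.1) p.2 (EuclideanSpace.single 2 1) b =
          μ p.1 (p.2 2) * fderiv ℝ (u p.1) p.2 (EuclideanSpace.single b 1) 2) →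
      (∀ p ∈ U,
        (1 - μ p.1 (p.2 2)) *
            (deriv (fun s => u s p.2 2) p.1 + fderiv ℝ (fun y => u p.1 y 2) p.2 (u p.1 p.2)
              - Δ (fun y => u p.1 y 2) p.2) =
          A p.1 (p.2 2) + (deriv (fun s => μ s (p.2 2)) p.1 - deriv (deriv (μ p.1)) (p.2 2)) * u p.1 p.2 2
            + deriv (μ p.1) (p.2 2) / 2 * u p.1 p.2 2 ^ 2
            - 2 * deriv (μ p.1) (p.2 2) * fderiv ℝ (u p.1) p.2 (EuclideanSpace.single 2 1) 2) →
      fderiv ℝ (fun y => fderiv ℝ (u p₀.1) y (EuclideanSpace.single 2 1) 2) p₀.2 (EuclideanSpace.single 0 1) *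
            fderiv ℝ (u p₀.1) p₀.2 (EuclideanSpace.single 1 1) 2 -
          fderiv ℝ (fun y => fderiv ℝ (u p₀.1) y (EuclideanSpace.single 2 1) 2) p₀.2 (EuclideanSpace.single 1 1) *
            fderiv ℝ (u p₀.1) p₀.2 (EuclideanSpace.single 0 1) 2 ≠ 0 →
      μ p₀.1 (p₀.2 2) ≠ 0 → μ p₀.1 (p₀.2 2) ≠ 1 → deriv (μ p₀.1) (p₀.2 2) ≠ 0 → False := by
  intro u μ A U p₀ hU hp₀ hu hμ hA hpol hdiv hsh hE htw hm0 hm1 hmz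
  exact not_localDatum_of_checkTree (v := dirVec) t (thHyps L) (thPins L) ht
    ⟨U, p₀, jetMapOf L u μ A, hU, hp₀, fun p hp => differentiableAt_jetMapOf hu hμ hA hp,
      fun j i hi p hp => tables_jetMapOf hU hu hμ hA j i hi hp,
      thHyps_vanish hL hU hu hμ hpol hdiv hsh hE, thPins_ne_zero hL hU hu hμ hp₀ htw hm0 hm1 hmz⟩

end Summit.NavierStokesRegularity.NavierStokesRegularity.Theorems.PoloidalWindowDoorLrcModEntireTHCert

end
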